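import Literature.MathematicalPhysics.QuantumLattice.HubbardSectorEnclosureCertificate
import HarnessLib

/-!
# Odd particle number: the Hubbard ground-state energy is attained in the sector `S^z = ½`
# (`(N↑, N↓) = (n + 1, n)`), and one-sector certificates for `N = 2n + 1`

Topic `MathematicalPhysics/QuantumLattice` (family `hubbard`); companion of
`HubbardRingPerronFrobeniusProofs.lean` (`groundEnergyAt_eq_minEnergyOn_szSector`: the EVEN case
`E₀(2n) = λ_min` on `szSector (2n) 0`) and `HubbardSectorEnclosureCertificate.lean`
(`groundEnergyAt_two_mul_ge_of_centralBlock_posSemidef`: one central-sector certificate bounds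
`E₀(2n)`). The `SU(2)` multiplet argument is parity-blind — every spin multiplet of the
`N`-particle space contains a vector with `S^z = (N mod 2)/2` (E. H. Lieb, PRL 62 (1989) 1201, proof
of Thm 1: "all competitors have a representative there"; H. Tasaki, *Physics and Mathematics of
Quantum Many-Body Systems* (2020) §2.2, §9.3) — and this file supplies the ODD half:

* `mem_szSector_two_mul_add_one_iff` — `szSector (2n+1) (1/2)` is the coordinate sector `(n+1, n)`;
* `groundEnergyAt_eq_minEnergyOn_szSector_odd` — for `n + 1 ≤ |Λ|`,
  `groundEnergyAt G t U (2n+1) = (hamiltonian G t U).minEnergyOn (szSector (2n+1) (1/2))`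
  (proof as in the even case: a ground state has a nonzero component in some sector `(a, b)`,
  `a + b = 2n + 1`, which the injective ladder maps `S⁻` (`a > b`) / `S⁺` (`a < b`) carry, without
  changing the energy, to the sector `(n+1, n)`);
* `groundEnergyAt_two_mul_add_one_ge_of_sectorBlock_posSemidef` — ONE SECTOR SUFFICES FOR ODD `N`:
  a positive-semidefinite certificate `H.toBlock (sector (n+1) n) (sector (n+1) n) − c·1 ⪰ 0` gives
  `c ≤ groundEnergyAt G t U (2n+1)` (so exact-diagonalisation / Gram / verified-Cholesky lower-bound
  certificates on the `(n+1, n)` block alone bound `E₀(2n+1)`, e.g. `N = 15` on the `4 × 4` torus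
  from the `(8, 7)` block);
* `groundEnergyAt_two_mul_add_one_ge_of_central_gram_certificate` — the Gram–Gershgorin form
  (`B − σ·1 = s⁻¹(Rᴴ R − E)`, row sums of `E` `≤ r` ⇒ `σ − r/s ≤ E₀(2n+1)`).

No definitions, no named facts.
-/

noncomputable section

open Matrix Finset
open scoped ComplexOrder BigOperators

namespace Literature.MathematicalPhysics.QuantumLattice

open HubbardWave0 RayleighBound

variable {Λ : Type*} [LinearOrder Λ] [Fintype Λ] (G : SimpleGraph Λ) [DecidableRel G.Adj]

omit [Fintype Λ] in
/-- **The joint sector `(N, S^z) = (2n + 1, ½)` is the coordinate sector `(N↑, N↓) = (n + 1, n)`.**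
Lieb, PRL 62 (1989) 1201, eq. (2). [folklore] -/
theorem mem_szSector_two_mul_add_one_iff [Fintype Λ] (n : ℕ) (ψ : Fock (Orb Λ)) :
    ψ ∈ szSector (2 * n + 1) (1 / 2 : ℝ) ↔ IsInSector (n + 1) n ψ := by
  have h := mem_szSector_iff_isInSector (n + 1) n ψ
  have e1 : n + 1 + n = 2 * n + 1 := by ring
  have e2 : (((n + 1 : ℕ) : ℝ) - n) / 2 = 1 / 2 := by push_cast; ring
  rwa [e1, e2] at h

/-- The sector data of `upDownSector_groundState` at `(a, b) = (n + 1, n)`, re-indexed to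
`szSector (2n + 1) (1/2)`: a ground state `ψ₁` of the sector exists and the sector energy bounds the
Rayleigh quotients of the sector. [folklore] -/
theorem szSector_groundState_odd (t U : ℝ) {n : ℕ} (hn : n + 1 ≤ Fintype.card Λ) :
    (∃ χ : Fock (Orb Λ), IsInSector (n + 1) n χ ∧ χ ≠ 0 ∧ hamiltonian G t U *ᵥ χ =
        (((hamiltonian G t U).minEnergyOn (szSector (2 * n + 1) (1 / 2)) : ℝ) : ℂ) • χ) ∧
      ∀ φ : Fock (Orb Λ), IsInSector (n + 1) n φ →
        (hamiltonian G t U).minEnergyOn (szSector (2 * n + 1) (1 / 2)) * (star φ ⬝ᵥ φ).re ≤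
          (expect (hamiltonian G t U) φ).re := by
  have e1 : n + 1 + n = 2 * n + 1 := by ring
  have e2 : (((n + 1 : ℕ) : ℝ) - n) / 2 = 1 / 2 := by push_cast; ring
  have h := upDownSector_groundState G t U hn (Nat.le_of_succ_le hn)
  rw [e1, e2] at h
  exact h

/-- **`E₀(2n + 1)` is the ground-state energy in the joint sector `(2n + 1, S^z = ½)`** (every spin
multiplet of the `(2n+1)`-particle space meets `S^z = ½`): `H` conserves `(N↑, N↓)` and commutes with
`S^±`; a ground state has a nonzero component in some sector `(a, b)`, `a + b = 2n + 1`, which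
`S⁻` (if `a > n + 1`) or `S⁺` (if `a < n + 1`) maps injectively, step by step and without changing the
energy, to a nonzero eigenvector in the sector `(n + 1, n)`. Lieb, PRL 62 (1989) 1201, proof of
Thm 1; Tasaki (2020) §2.2. [cite: LiebPRL1989, proof of Theorem 1] -/
theorem groundEnergyAt_eq_minEnergyOn_szSector_odd (t U : ℝ) {n : ℕ}
    (hn : n + 1 ≤ Fintype.card Λ) :
    groundEnergyAt G t U (2 * n + 1) =
      (hamiltonian G t U).minEnergyOn (szSector (2 * n + 1) (1 / 2)) := by
  classical
  set H := hamiltonian G t U with hH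
  set E₀ : ℝ := groundEnergyAt G t U (2 * n + 1) with hE₀
  set E₁ : ℝ := H.minEnergyOn (szSector (2 * n + 1) (1 / 2)) with hE₁
  obtain ⟨⟨ψ₁, hψ₁, hψ₁0, -⟩, hb⟩ := szSector_groundState_odd G t U hn
  -- `E₀ ≤ E₁`: the sector Rayleigh set is contained in the `N`-particle one
  have hle : E₀ ≤ E₁ := by
    have hE₀' : E₀ = groundEnergy H (2 * n + 1) := rfl
    rw [hE₀', groundEnergy, hE₁, Matrix.minEnergyOn]
    refine csInf_le_csInf (LiebThm1.bddBelow_energySet H (2 * n + 1)) ?_ ?_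
    · obtain ⟨c, -, hc1⟩ := Literature.MathematicalPhysics.QuantumLattice.exists_smul_unit hψ₁0
      have hmem : ψ₁ ∈ szSector (2 * n + 1) (1 / 2 : ℝ) :=
        (mem_szSector_two_mul_add_one_iff n ψ₁).2 hψ₁
      exact ⟨_, c • ψ₁, Submodule.smul_mem _ c hmem, hc1, rfl⟩
    · rintro E ⟨φ, hφ, hφ1, rfl⟩
      exact ⟨φ, ((mem_szSector_iff _ _ _).1 hφ).1, hφ1, rfl⟩
  -- a ground state in the `N`-particle sector
  obtain ⟨α₁, -, hα₁⟩ : ∃ α₁ : Finset Λ, α₁ ⊆ univ ∧ α₁.card = n + 1 :=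
    Finset.exists_subset_card_eq (by rwa [Finset.card_univ])
  obtain ⟨α₀, -, hα₀⟩ : ∃ α₀ : Finset Λ, α₀ ⊆ univ ∧ α₀.card = n :=
    Finset.exists_subset_card_eq (by rw [Finset.card_univ]; exact Nat.le_of_succ_le hn)
  have hp : ∃ s : Finset (Orb Λ), s.card = 2 * n + 1 :=
    ⟨pairSet α₁ α₀, by rw [card_pairSet, hα₁, hα₀]; ring⟩
  have hinv : ∀ s s' : Finset (Orb Λ), ¬(s.card = 2 * n + 1) → s'.card = 2 * n + 1 → H s s' = 0 := by
    intro s s' hs hs'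
    by_contra h
    have := LiebThm1.preservesSectors_hamiltonian G t U s s' h
    apply hs
    rw [card_eq_upPart_add_downPart, this.1, this.2, ← card_eq_upPart_add_downPart, hs']
  obtain ⟨⟨v, hv, hv0, hHv⟩, -⟩ := Literature.MathematicalPhysics.QuantumLattice.sector_groundState H
    (LiebThm1.hamiltonian_isHermitian G t U) (fun s : Finset (Orb Λ) => s.card = 2 * n + 1) hp hinv
    (nParticleSubmodule (2 * n + 1)) (fun v => Iff.rfl)
  have hvN : IsNParticle (2 * n + 1) v := hv
  have hE₀v : H *ᵥ v = (E₀ : ℂ) • v := by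
    rw [hHv, hE₀, groundEnergyAt,
      groundEnergy_eq_minEnergyOn H (2 * n + 1) (nParticleSubmodule (2 * n + 1)) fun ψ => Iff.rfl]
  -- `S^±` map eigenvectors to eigenvectors
  have hcommP : Commute H spinPlus := LiebThm1.hamiltonian_commute_spinPlus G t U
  have hcommM : Commute H Literature.MathematicalPhysics.QuantumLattice.spinMinus :=
    LiebThm1.hamiltonian_commute_spinMinus G t U
  have heigP : ∀ w : Fock (Orb Λ), H *ᵥ w = (E₀ : ℂ) • w →
      H *ᵥ (spinPlus *ᵥ w) = (E₀ : ℂ) • (spinPlus *ᵥ w) := by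
    intro w hw
    rw [mulVec_mulVec, hcommP.eq, ← mulVec_mulVec, hw, mulVec_smul]
  have heigM : ∀ w : Fock (Orb Λ), H *ᵥ w = (E₀ : ℂ) • w →
      H *ᵥ (Literature.MathematicalPhysics.QuantumLattice.spinMinus *ᵥ w) =
        (E₀ : ℂ) • (Literature.MathematicalPhysics.QuantumLattice.spinMinus *ᵥ w) := by
    intro w hw
    rw [mulVec_mulVec, hcommM.eq, ← mulVec_mulVec, hw, mulVec_smul]
  -- descent to the `(n + 1, n)` sector with `S⁻` (from `a > n + 1`)
  have hB : ∀ j b : ℕ, ∀ w : Fock (Orb Λ), b + (j + 1) = n → IsInSector (b + 2 * (j + 1) + 1) b w →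
      H *ᵥ w = (E₀ : ℂ) • w → w ≠ 0 →
      ∃ w' : Fock (Orb Λ), IsInSector (n + 1) n w' ∧ H *ᵥ w' = (E₀ : ℂ) • w' ∧ w' ≠ 0 := by
    intro j
    induction j with
    | zero =>
      intro b w hb hw hHw hw0
      have hw' : IsInSector (b + 2 * (0 + 1)) (b + 1)
          (Literature.MathematicalPhysics.QuantumLattice.spinMinus *ᵥ w) :=
        LiebThm1.lowersSpin_spinMinus.isInSector_mulVec hw
      have e : b + 2 * (0 + 1) = n + 1 := by omega
      have hn' : b + 1 = n := by omega
      rw [e, hn'] at hw'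
      exact ⟨_, hw', heigM w hHw,
        fun h0 => hw0 (LiebThm1.eq_zero_of_spinMinus_mulVec_eq_zero (by omega) hw h0)⟩
    | succ j ih =>
      intro b w hb hw hHw hw0
      have e : b + 2 * (j + 1 + 1) + 1 = (b + 1 + 2 * (j + 1) + 1) + 1 := by ring
      rw [e] at hw
      have hw' : IsInSector (b + 1 + 2 * (j + 1) + 1) (b + 1)
          (Literature.MathematicalPhysics.QuantumLattice.spinMinus *ᵥ w) :=
        LiebThm1.lowersSpin_spinMinus.isInSector_mulVec hw
      exact ih (b + 1) _ (by omega) hw' (heigM w hHw)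
        fun h0 => hw0 (LiebThm1.eq_zero_of_spinMinus_mulVec_eq_zero (by omega) hw h0)
  -- ascent to the `(n + 1, n)` sector with `S⁺` (from `a < n + 1`)
  have hB' : ∀ j a : ℕ, ∀ w : Fock (Orb Λ), a + (j + 1) = n + 1 → IsInSector a (a + 2 * j + 1) w →
      H *ᵥ w = (E₀ : ℂ) • w → w ≠ 0 →
      ∃ w' : Fock (Orb Λ), IsInSector (n + 1) n w' ∧ H *ᵥ w' = (E₀ : ℂ) • w' ∧ w' ≠ 0 := by
    intro j
    induction j with
    | zero =>
      intro a w ha hw hHw hw0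
      have hw' : IsInSector (a + 1) (a + 2 * 0) (spinPlus *ᵥ w) :=
        LiebThm1.raisesSpin_spinPlus.isInSector_mulVec hw
      have e : a + 1 = n + 1 := by omega
      have hn' : a + 2 * 0 = n := by omega
      rw [e, hn'] at hw'
      exact ⟨_, hw', heigP w hHw,
        fun h0 => hw0 (LiebThm1.eq_zero_of_spinPlus_mulVec_eq_zero (by omega) hw h0)⟩
    | succ j ih =>
      intro a w ha hw hHw hw0
      have hw' : IsInSector (a + 1) (a + 2 * (j + 1)) (spinPlus *ᵥ w) :=
        LiebThm1.raisesSpin_spinPlus.isInSector_mulVec hw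
      have e : a + 2 * (j + 1) = (a + 1) + 2 * j + 1 := by ring
      rw [e] at hw'
      exact ih (a + 1) _ (by omega) hw' (heigP w hHw)
        fun h0 => hw0 (LiebThm1.eq_zero_of_spinPlus_mulVec_eq_zero (by omega) hw h0)
  -- some sector component of `v` is nonzero; move it to the `(n + 1, n)` sector
  have hcomp : ∀ a b : ℕ, H *ᵥ sectorProj a b v = (E₀ : ℂ) • sectorProj a b v := by
    intro a b
    rw [(LiebThm1.preservesSectors_hamiltonian G t U).mulVec_sectorProj, hE₀v, sectorProj_smul]
  obtain ⟨a, ha, hva⟩ : ∃ a ∈ range (2 * n + 1 + 1), sectorProj a (2 * n + 1 - a) v ≠ 0 := by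
    by_contra h
    simp only [not_exists, not_and, not_not] at h
    exact hv0 ((sum_sectorProj_eq hvN).symm.trans (Finset.sum_eq_zero h))
  obtain ⟨w, hw, hHw, hw0⟩ : ∃ w : Fock (Orb Λ),
      IsInSector (n + 1) n w ∧ H *ᵥ w = (E₀ : ℂ) • w ∧ w ≠ 0 := by
    rw [mem_range] at ha
    rcases lt_trichotomy a (n + 1) with hlt | rfl | hgt
    · obtain ⟨j, hj⟩ : ∃ j, a + (j + 1) = n + 1 := ⟨n - a, by omega⟩
      have e : 2 * n + 1 - a = a + 2 * j + 1 := by omega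
      refine hB' j a _ hj ?_ (hcomp _ _) hva
      rw [e]
      exact isInSector_sectorProj _ _ _
    · refine ⟨_, ?_, hcomp (n + 1) (2 * n + 1 - (n + 1)), hva⟩
      rw [show 2 * n + 1 - (n + 1) = n by omega]
      exact isInSector_sectorProj _ _ _
    · obtain ⟨j, hj⟩ : ∃ j, (2 * n + 1 - a) + (j + 1) = n := ⟨a - n - 2, by omega⟩
      have e : a = (2 * n + 1 - a) + 2 * (j + 1) + 1 := by omega
      refine hB j (2 * n + 1 - a) _ hj ?_ (hcomp _ _) hva
      rw [← e]
      exact isInSector_sectorProj _ _ _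
  -- hence `E₁ ≤ E₀`
  have hge : E₁ ≤ E₀ := by
    have h1 := hb w hw
    rw [expect, hHw, dotProduct_smul, smul_eq_mul, Complex.re_ofReal_mul] at h1
    have hpos : 0 < (star w ⬝ᵥ w).re :=
      (Complex.pos_iff.1 (dotProduct_star_self_pos_iff.2 hw0)).1
    exact le_of_mul_le_mul_right h1 hpos
  exact le_antisymm hle hge

/-- **One sector suffices for `N = 2n + 1`**: a PSD certificate on the block
`H.toBlock (sectorPred (n+1) n) (sectorPred (n+1) n) − c·1 ⪰ 0` (`n + 1 ≤ |Λ|`) gives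
`c ≤ groundEnergyAt G t U (2n + 1)`, because every spin multiplet of the `(2n+1)`-particle space
meets the `S^z = ½` sector (`groundEnergyAt_eq_minEnergyOn_szSector_odd`). Lieb (1989), proof of
Thm 1; Tasaki (2020) §2.2. [folklore] -/
theorem groundEnergyAt_two_mul_add_one_ge_of_sectorBlock_posSemidef (t U : ℝ) {n : ℕ}
    (hn : n + 1 ≤ Fintype.card Λ) {c : ℝ}
    (h : ((hamiltonian G t U).toBlock (Hubbard.sectorPred (n + 1) n) (Hubbard.sectorPred (n + 1) n) -
      (c : ℂ) • (1 : Matrix _ _ ℂ)).PosSemidef) :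
    c ≤ groundEnergyAt G t U (2 * n + 1) := by
  rw [groundEnergyAt_eq_minEnergyOn_szSector_odd G t U hn]
  obtain ⟨⟨ψ₁, hψ₁, hψ₁0, -⟩, -⟩ := szSector_groundState_odd G t U hn
  unfold Matrix.minEnergyOn
  refine le_csInf ?_ ?_
  · obtain ⟨d, -, hd1⟩ := Literature.MathematicalPhysics.QuantumLattice.exists_smul_unit hψ₁0
    exact ⟨_, d • ψ₁, Submodule.smul_mem _ _ ((mem_szSector_two_mul_add_one_iff n ψ₁).2 hψ₁),
      hd1, rfl⟩
  · rintro E ⟨ψ, hψ, hψ1, rfl⟩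
    have hsec : IsInSector (n + 1) n ψ := (mem_szSector_two_mul_add_one_iff n ψ).1 hψ
    have hle := Hubbard.mul_normSq_le_of_sectorBlock_posSemidef (hamiltonian G t U) h ψ hsec
    have hnorm : normSq ψ = 1 := by
      have h3 := star_dotProduct_self_eq_normSq ψ
      rw [hψ1] at h3
      exact_mod_cast h3.symm
    rw [hnorm, mul_one] at hle
    exact hle

/-- **Central-sector Gram–Gershgorin certificate for odd `N = 2n + 1`** (`n + 1 ≤ |Λ|`):
`B_{(n+1)n} − σ·1 = s⁻¹ • (Rᴴ R − E)`, `E` Hermitian with absolute row sums `≤ r`, `s > 0` ⇒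
`σ − r/s ≤ groundEnergyAt G t U (2n + 1)`. [folklore] -/
theorem groundEnergyAt_two_mul_add_one_ge_of_central_gram_certificate (t U : ℝ) {n : ℕ}
    (hn : n + 1 ≤ Fintype.card Λ) {σ s r : ℝ} {k : Type*} [Fintype k]
    (R : Matrix k {x : Finset (Orb Λ) // Hubbard.sectorPred (n + 1) n x} ℂ)
    {E : Matrix {x : Finset (Orb Λ) // Hubbard.sectorPred (n + 1) n x}
      {x : Finset (Orb Λ) // Hubbard.sectorPred (n + 1) n x} ℂ}
    (hE : E.IsHermitian) (hs : 0 < s) (hrow : ∀ i, ∑ j, ‖E i j‖ ≤ r)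
    (hid : (hamiltonian G t U).toBlock (Hubbard.sectorPred (n + 1) n) (Hubbard.sectorPred (n + 1) n) -
      (σ : ℂ) • (1 : Matrix _ _ ℂ) = ((s⁻¹ : ℝ) : ℂ) • (Rᴴ * R - E)) :
    σ - r / s ≤ groundEnergyAt G t U (2 * n + 1) :=
  groundEnergyAt_two_mul_add_one_ge_of_sectorBlock_posSemidef G t U hn
    (posSemidef_sub_of_gram_certificate R hE hs hrow hid)

end Literature.MathematicalPhysics.QuantumLattice

end
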